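import Summits.QuantumFields.GaugeBoot.BootstrapExactCertificates
import Summits.QuantumFields.GaugeBoot.GaugeInvariantBootstrapCertificates
import HarnessLib

/-!
# Exact certificates on gauge-invariant data: the gauge-averaged certificate cone is closed (gauge-boot, L1/L4 supplement)

HONEST FRAMING (cell `pub-gaugeboot`, page 1 of every file): the venture produces certified bounds
on lattice expectations at stated coupling, gauge group, dimension and torus size; NOT a mass gap,
NOT a continuum limit, NOT a string tension; NOT Yang–Mills-summit-bearing (barriers
`FixedCouplingUltralocality`, `PerturbativeInvisibility`). Structural; it certifies no number.

## Content

`GaugeInvariantBootstrapCertificates` certified every constant STRICTLY above the SDP maximum on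
gauge-invariant data (Kazakov–Zheng 2024 form) by gauge-AVERAGED squares plus gauge-averaged rows.
Here the `ε` is removed, as in `BootstrapExactCertificates` for the un-averaged bootstrap:

* ★ `isClosed_map_sosCone_add_of_faithful` — the image `T(SOS(span m) + L)` under a linear map `T`
  is closed whenever a bounded functional `φ` with `φ ∘ T = φ`, vanishing on `L` and strictly
  positive on the non-zero squares of `span m`, exists (`m` linearly independent, `L`
  finite-dimensional; the argument of `isClosed_sosCone_add_of_faithful` with `T` inserted — the
  gauge-invariance of the Wilson state is what makes it go through for `T = A`);
* ★★ `isClosed_gaugeCertConeSuN` — `SU(N)` on `(ℤ/L)^d`, every `β`, every level: the gauge-averaged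
  certificate cone is closed;
* ★★★ `forall_gaugeLevelValues_le_iff_mem_map_suN`, `sSup_smul_one_sub_mem_gaugeCertCone_suN` — EXACT
  duality on gauge-invariant data: for a gauge-invariant `P` in the level-`n` certificate domain,
  `t ≤ c` for every level-`n` feasible value on gauge-invariant data iff `c • 1 - P = A σ + A ρ`;
  the optimum itself is so certified.

References: Kazakov–Zheng, arXiv:2404.16925; Rockafellar, Convex Analysis §9. Folklore.
-/

noncomputable section

open MeasureTheory Filter Topology NormedSpace Matrix
open scoped MatrixOrder Matrix.Norms.Elementwise
open Literature.MathematicalPhysics.QuantumFieldTheory (LatticeRep Edge GaugeConfig IsGaugeInvariant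
  wilsonAction wilsonMeasure isProbabilityMeasure_wilsonMeasure)
open Literature.MathematicalPhysics.QuantumLattice

namespace Summit.QuantumFields.GaugeBoot

open OrderUnitDuality

/-! ## Closedness of a linear image of `SOS + L` -/

section Closed

variable {ι : Type*} {G : Type*} [TopologicalSpace G] [CompactSpace G] {σ : Type*} [Fintype σ]
  [DecidableEq σ]

/-- ★ **`T(SOS(span m) + L)` is closed** when `m` is linearly independent, `L` is finite-dimensional,
and some linear `φ`, bounded by the sup norm, INVARIANT under `T`, vanishes on `L` and is strictly
positive on the non-zero squares of `span m`. [folklore] -/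
theorem isClosed_map_sosCone_add_of_faithful (m : σ → C(ι → G, ℝ)) (hm : LinearIndependent ℝ m)
    (L : Submodule ℝ C(ι → G, ℝ)) [FiniteDimensional ℝ L] (T : C(ι → G, ℝ) →ₗ[ℝ] C(ι → G, ℝ))
    (φ : C(ι → G, ℝ) →ₗ[ℝ] ℝ) (hφT : ∀ x, φ (T x) = φ x)
    (hφL : ∀ x ∈ L, φ x = 0) {C : ℝ} (hC : 0 ≤ C) (hφC : ∀ f, φ f ≤ C * ‖f‖)
    (hφpos : ∀ v ∈ Submodule.span ℝ (Set.range m), v ≠ 0 → 0 < φ (v * v)) :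
    IsClosed {y : C(ι → G, ℝ) | ∃ s ∈ sosCone (Submodule.span ℝ (Set.range m) : Set C(ι → G, ℝ)),
      ∃ ρ ∈ L, T (s + ρ) = y} := by
  -- (1) `φ ∘ gramForm` is positive on non-zero PSD matrices
  have hpos : ∀ Q : Matrix σ σ ℝ, Q.PosSemidef → Q ≠ 0 → 0 < φ (gramForm m Q) := by
    intro Q hQ hQ0
    have hQ' : (0 : Matrix σ σ ℝ) ≤ Q := Matrix.nonneg_iff_posSemidef.2 hQ
    rw [StarOrderedRing.nonneg_iff] at hQ'
    have key : ∀ Q ∈ AddSubmonoid.closure (Set.range fun s : Matrix σ σ ℝ => star s * s),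
        0 ≤ φ (gramForm m Q) ∧ (φ (gramForm m Q) = 0 → Q = 0) := by
      intro Q hQ
      induction hQ using AddSubmonoid.closure_induction with
      | mem Q₁ hQ₁ =>
        obtain ⟨B, rfl⟩ := Set.mem_range.1 hQ₁
        have hB : star B * B = Bᵀ * B := by rw [Matrix.star_eq_conjTranspose]; rfl
        rw [hB, gramForm_transpose_mul_self, map_sum]
        have hnn : ∀ k, 0 ≤ φ ((∑ i, B k i • m i) * (∑ i, B k i • m i)) := fun k => by
          by_cases h0 : ∑ i, B k i • m i = 0
          · rw [h0, mul_zero, map_zero]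
          · exact (hφpos _ (Submodule.sum_mem _ fun i _ =>
              Submodule.smul_mem _ _ (Submodule.subset_span (Set.mem_range_self i))) h0).le
        refine ⟨Finset.sum_nonneg fun k _ => hnn k, fun hsum => ?_⟩
        have hrow : ∀ k, ∑ i, B k i • m i = 0 := fun k => by
          by_contra h0
          have hk := hφpos _ (Submodule.sum_mem _ fun i _ =>
            Submodule.smul_mem _ _ (Submodule.subset_span (Set.mem_range_self i))) h0
          have := (Finset.sum_eq_zero_iff_of_nonneg fun k _ => hnn k).1 hsum k (Finset.mem_univ k)
          linarith
        have hB0 : B = 0 := by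
          ext k i
          rw [Matrix.zero_apply]
          exact linearIndependent_iff'.1 hm Finset.univ (fun i => B k i) (hrow k) i (Finset.mem_univ i)
        rw [hB0, Matrix.mul_zero]
      | zero => exact ⟨by rw [gramForm_zero, map_zero], fun _ => rfl⟩
      | add Q₁ Q₂ _ _ h₁ h₂ =>
        rw [gramForm_add, map_add]
        refine ⟨add_nonneg h₁.1 h₂.1, fun h => ?_⟩
        have e1 : φ (gramForm m Q₁) = 0 := by linarith [h₁.1, h₂.1]
        have e2 : φ (gramForm m Q₂) = 0 := by linarith [h₁.1, h₂.1]
        rw [h₁.2 e1, h₂.2 e2, add_zero]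
    obtain ⟨hnn, hzero⟩ := key Q hQ'
    exact lt_of_le_of_ne hnn fun h => hQ0 (hzero h.symm)
  -- (2) a uniform constant `δ ‖Q‖ ≤ φ (gramForm Q)` on the PSD cone
  obtain ⟨δ, hδ, hdom⟩ : ∃ δ : ℝ, 0 < δ ∧ ∀ Q : Matrix σ σ ℝ, Q.PosSemidef → δ * ‖Q‖ ≤ φ (gramForm m Q) := by
    set B := {Q : Matrix σ σ ℝ | Q.PosSemidef} ∩ Metric.sphere (0 : Matrix σ σ ℝ) 1 with hB
    have hBc : IsCompact B := Metric.isCompact_of_isClosed_isBounded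
      (isClosed_setOf_posSemidef.inter Metric.isClosed_sphere)
      (Metric.isBounded_sphere.subset Set.inter_subset_right)
    have hcont : Continuous fun Q : Matrix σ σ ℝ => φ (gramForm m Q) :=
      (φ ∘ₗ gramFormₗ m).continuous_of_finiteDimensional
    by_cases hne : B.Nonempty
    · obtain ⟨Q₀, hQ₀B, hmin⟩ := hBc.exists_isMinOn hne hcont.continuousOn
      have hQ₀ne : Q₀ ≠ 0 := by
        intro h; have := hQ₀B.2; rw [h, Metric.mem_sphere, dist_self] at this; exact zero_ne_one this
      refine ⟨φ (gramForm m Q₀), hpos Q₀ hQ₀B.1 hQ₀ne, fun Q hQ => ?_⟩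
      by_cases hQ0 : Q = 0
      · rw [hQ0, norm_zero, mul_zero, gramForm_zero, map_zero]
      · have hnorm : 0 < ‖Q‖ := norm_pos_iff.2 hQ0
        have hmem : ‖Q‖⁻¹ • Q ∈ B := by
          refine ⟨hQ.smul (inv_nonneg.2 hnorm.le), ?_⟩
          rw [Metric.mem_sphere, dist_zero_right, norm_smul, norm_inv, norm_norm,
            inv_mul_cancel₀ hnorm.ne']
        have h := (isMinOn_iff.1 hmin) _ hmem
        rw [gramForm_smul, map_smul, smul_eq_mul, le_inv_mul_iff₀ hnorm] at h
        rw [mul_comm]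
        exact h
    · refine ⟨1, one_pos, fun Q hQ => ?_⟩
      by_cases hQ0 : Q = 0
      · rw [hQ0, norm_zero, mul_zero, gramForm_zero, map_zero]
      · exfalso
        have hnorm : 0 < ‖Q‖ := norm_pos_iff.2 hQ0
        refine hne ⟨‖Q‖⁻¹ • Q, hQ.smul (inv_nonneg.2 hnorm.le), ?_⟩
        rw [Metric.mem_sphere, dist_zero_right, norm_smul, norm_inv, norm_norm,
          inv_mul_cancel₀ hnorm.ne']
  -- (3) sequential closedness
  refine IsSeqClosed.isClosed fun y z hy hyz => ?_
  choose s hs ρ hρ hsum using hy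
  choose Q hQ hGQ using fun k => exists_posSemidef_of_mem_sosCone m (hs k)
  obtain ⟨R, hR⟩ : ∃ R, ∀ k, ‖y k‖ ≤ R := by
    obtain ⟨R, hR⟩ := (Metric.isBounded_range_of_tendsto y hyz).exists_norm_le
    exact ⟨R, fun k => hR _ (Set.mem_range_self k)⟩
  have hQbd : ∀ k, ‖Q k‖ ≤ C * R / δ := by
    intro k
    have h1 := hdom (Q k) (hQ k)
    have h2 : φ (gramForm m (Q k)) = φ (y k) := by
      rw [← hsum k, hφT, map_add, hφL _ (hρ k), add_zero, hGQ k]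
    have h3 : φ (y k) ≤ C * R := (hφC (y k)).trans (mul_le_mul_of_nonneg_left (hR k) hC)
    rw [le_div_iff₀ hδ, mul_comm]
    linarith
  obtain ⟨Qlim, -, ψ, hψ, hlim⟩ := (isCompact_closedBall (0 : Matrix σ σ ℝ) (C * R / δ)).tendsto_subseq
    (x := Q) fun k => by
      rw [Metric.mem_closedBall, dist_zero_right]; exact hQbd k
  have hQlim : Qlim.PosSemidef := isClosed_setOf_posSemidef.mem_of_tendsto hlim
    (Eventually.of_forall fun k => hQ (ψ k))
  -- `T` restricted to the finite-dimensional pieces is continuous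
  have hTG : Continuous fun Q : Matrix σ σ ℝ => T (gramForm m Q) :=
    (T ∘ₗ gramFormₗ m).continuous_of_finiteDimensional
  have hρlim : Tendsto (fun k => T (ρ (ψ k))) atTop (𝓝 (z - T (gramForm m Qlim))) := by
    have h1 : Tendsto (fun k => y (ψ k)) atTop (𝓝 z) := hyz.comp hψ.tendsto_atTop
    have h2 : Tendsto (fun k => T (gramForm m (Q (ψ k)))) atTop (𝓝 (T (gramForm m Qlim))) :=
      hTG.continuousAt.tendsto.comp hlim
    have h3 : (fun k => T (ρ (ψ k))) = fun k => y (ψ k) - T (gramForm m (Q (ψ k))) := by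
      funext k; rw [← hsum (ψ k), hGQ, map_add]; abel
    rw [h3]
    exact h1.sub h2
  haveI : FiniteDimensional ℝ (L.map T) := inferInstance
  have hmem : z - T (gramForm m Qlim) ∈ L.map T :=
    ((L.map T).closed_of_finiteDimensional).mem_of_tendsto hρlim
      (Eventually.of_forall fun k => Submodule.mem_map_of_mem (hρ (ψ k)))
  obtain ⟨ρ', hρ', hTρ'⟩ := Submodule.mem_map.1 hmem
  refine ⟨gramForm m Qlim, (mem_sosCone_span_iff_exists_posSemidef m).2 ⟨Qlim, hQlim, rfl⟩,
    ρ', hρ', ?_⟩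
  rw [map_add, hTρ']
  abel

end Closed

/-! ## `SU(N)` on the torus: exact gauge-averaged certificates -/

section SuN

variable {d L : ℕ} [NeZero L] (N : ℕ) (β : ℝ)

/-- ★★ **The gauge-averaged level-`n` certificate cone is closed.** [folklore] -/
theorem isClosed_gaugeCertConeSuN (n : ℕ) :
    IsClosed (gaugeCertConeSuN (d := d) (L := L) N β n :
      Set C(GaugeConfig d L (Matrix.specialUnitaryGroup (Fin N) ℂ), ℝ)) := by
  classical
  haveI hP : IsProbabilityMeasure (wilsonMeasure (d := d) (L := L) (fundamentalRep (Fin N)) β) :=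
    isProbabilityMeasure_wilsonMeasure (ρ := fundamentalRep (Fin N)) (continuous_fundamentalRep _) β
  set W : Submodule ℝ C(GaugeConfig d L (Matrix.specialUnitaryGroup (Fin N) ℂ), ℝ) :=
    Submodule.span ℝ (wordsUpTo (ι := Edge d L) (fundamentalLatticeRep N) n) with hW
  haveI : FiniteDimensional ℝ W :=
    FiniteDimensional.span_of_finite ℝ (wordsUpTo_finite (fundamentalLatticeRep N) n)
  let b := Module.finBasis ℝ W
  let m : Fin (Module.finrank ℝ W) → C(GaugeConfig d L (Matrix.specialUnitaryGroup (Fin N) ℂ), ℝ) :=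
    fun i => (b i : C(GaugeConfig d L (Matrix.specialUnitaryGroup (Fin N) ℂ), ℝ))
  have hm : LinearIndependent ℝ m := b.linearIndependent.map' W.subtype W.ker_subtype
  have hspan : Submodule.span ℝ (Set.range m) = W := by
    show Submodule.span ℝ (Set.range (W.subtype ∘ b)) = W
    rw [Set.range_comp, ← Submodule.map_span, b.span_eq, Submodule.map_top, Submodule.range_subtype]
  set Lr := rowSpace (fundamentalLatticeRep N) (suExp N) (fun _ => wilsonAction (fundamentalRep (Fin N)))
    β (wordTruncation (ι := Edge d L) (fundamentalLatticeRep N) n) with hLr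
  haveI : FiniteDimensional ℝ
      (Submodule.span ℝ (wordsUpTo (ι := Edge d L) (fundamentalLatticeRep N) (n + 4))) :=
    FiniteDimensional.span_of_finite ℝ (wordsUpTo_finite (fundamentalLatticeRep N) (n + 4))
  haveI : FiniteDimensional ℝ Lr :=
    Submodule.finiteDimensional_of_le (Submodule.span_le.2 (rowSet_subset_wordTruncation_suN N β n))
  set φ := expectationFunctional (wilsonMeasure (d := d) (L := L) (fundamentalRep (Fin N)) β) with hφ
  have hfeas := isBootstrapFeasible_wilson_suN (d := d) (L := L) N β _ rfl
    (wordTruncation_subset_polyAlgebra (fundamentalLatticeRep N) n)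
  have hφT : ∀ x, φ (gaugeAvgL d L (Matrix.specialUnitaryGroup (Fin N) ℂ) x) = φ x := fun x => by
    have h := expectationFunctional_comp_gaugeAvgL_of_eq_wilson (d := d) (L := L)
      (fundamentalRep (Fin N)) β _ rfl
    exact (LinearMap.congr_fun h x :)
  have hφL : ∀ x ∈ Lr, φ x = 0 := fun x hx => hfeas.apply_eq_zero_of_mem_rowSpace _ hx
  have hφC : ∀ f, φ f ≤ 1 * ‖f‖ := expectationFunctional_le_norm _
  haveI : IsProbabilityMeasure (wilsonMeasure (d := d) (L := L) (fundamentalLatticeRep N).ρ β) := hP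
  have hφpos : ∀ v ∈ Submodule.span ℝ (Set.range m), v ≠ 0 → 0 < φ (v * v) := by
    intro v _ hv
    refine lt_of_le_of_ne (expectationFunctional_sq_nonneg _ v) fun h => hv ?_
    exact eq_zero_of_wilson_integral_mul_self_eq_zero (fundamentalLatticeRep N) β v h.symm
  have hclosed := isClosed_map_sosCone_add_of_faithful m hm Lr
    (gaugeAvgL d L (Matrix.specialUnitaryGroup (Fin N) ℂ)) φ hφT hφL zero_le_one hφC hφpos
  have hset : (wordTruncation (ι := Edge d L) (fundamentalLatticeRep N) n) =
      (Submodule.span ℝ (Set.range m) : Set _) := by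
    rw [hspan]; rfl
  have hsos : sosCone (wordTruncation (ι := Edge d L) (fundamentalLatticeRep N) n) =
      sosCone (Submodule.span ℝ (Set.range m) : Set _) := by rw [hset]
  convert hclosed using 1
  ext y
  rw [SetLike.mem_coe, PointedCone.mem_map]
  constructor
  · rintro ⟨x, hx, rfl⟩
    obtain ⟨s, hs, ρ, hρ, rfl⟩ := (mem_certCone_iff _).1 hx
    rw [hsos] at hs
    exact ⟨s, hs, ρ, hρ, rfl⟩
  · rintro ⟨s, hs, ρ, hρ, rfl⟩
    rw [← hsos] at hs
    exact ⟨s + ρ, (mem_certCone_iff _).2 ⟨s, hs, ρ, hρ, rfl⟩, rfl⟩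

/-- ★★★ **Exact duality on gauge-invariant data** (no `ε`): for a gauge-invariant `P` in the
level-`n` certificate domain, every level-`n` feasible value of the bootstrap on gauge-invariant
data is `≤ c` iff `c • 1 - P` is a gauge-averaged SOS plus gauge-averaged rows. [folklore] -/
theorem forall_gaugeLevelValues_le_iff_mem_map_suN {n : ℕ}
    {P : C(GaugeConfig d L (Matrix.specialUnitaryGroup (Fin N) ℂ), ℝ)} (hPi : IsGaugeInvariant (⇑P))
    (hP : P ∈ certDomainSuN (d := d) (L := L) N β n) {c : ℝ} :
    (∀ t ∈ gaugeLevelValuesSuN (d := d) (L := L) N β n P, t ≤ c) ↔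
      c • (1 : C(GaugeConfig d L (Matrix.specialUnitaryGroup (Fin N) ℂ), ℝ)) - P ∈
        gaugeCertConeSuN (d := d) (L := L) N β n := by
  refine ⟨fun h => ?_, fun hc => gaugeLevelValues_le_of_mem_map_suN N β hc⟩
  have hcl : IsClosed {t : ℝ | t • (1 : C(GaugeConfig d L (Matrix.specialUnitaryGroup (Fin N) ℂ), ℝ))
      - P ∈ gaugeCertConeSuN (d := d) (L := L) N β n} :=
    (isClosed_gaugeCertConeSuN N β n).preimage
      ((continuous_id.smul continuous_const).sub continuous_const)
  have hIoi : Set.Ioi c ⊆ {t : ℝ | t • (1 : C(GaugeConfig d L (Matrix.specialUnitaryGroup (Fin N) ℂ), ℝ))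
      - P ∈ gaugeCertConeSuN (d := d) (L := L) N β n} := by
    intro t ht
    obtain ⟨σ, hσ, ρ, hρ, hcert⟩ := exists_gauge_certificate_suN N β hPi hP h ht
    rw [Set.mem_setOf_eq, ← hcert, ← map_add]
    exact PointedCone.mem_map.2 ⟨σ + ρ, (mem_certCone_iff _).2 ⟨σ, hσ, ρ, hρ, rfl⟩, rfl⟩
  have hmem : c ∈ closure (Set.Ioi c) := by rw [closure_Ioi]; exact Set.self_mem_Ici
  exact hcl.closure_subset_iff.2 hIoi hmem

/-- ★★★ **Dual attainment on gauge-invariant data**: the SDP optimum on gauge-invariant data is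
itself certified by gauge-averaged squares plus gauge-averaged rows. [folklore] -/
theorem sSup_smul_one_sub_mem_gaugeCertCone_suN {n : ℕ}
    {P : C(GaugeConfig d L (Matrix.specialUnitaryGroup (Fin N) ℂ), ℝ)} (hPi : IsGaugeInvariant (⇑P))
    (hP : P ∈ certDomainSuN (d := d) (L := L) N β n) :
    sSup (gaugeLevelValuesSuN (d := d) (L := L) N β n P) •
        (1 : C(GaugeConfig d L (Matrix.specialUnitaryGroup (Fin N) ℂ), ℝ)) - P ∈
      gaugeCertConeSuN (d := d) (L := L) N β n := by
  -- the gauge-level values are bounded above (inside the level values, a compact interval)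
  obtain ⟨lo, hi, hIcc, -⟩ := levelValues_eq_Icc_suN N β hP
  have hbdd : BddAbove (gaugeLevelValuesSuN (d := d) (L := L) N β n P) := by
    refine ⟨hi, fun t ht => ?_⟩
    have h := gaugeLevelValues_subset_levelValues_suN N β n hPi ht
    rw [hIcc] at h
    exact h.2
  exact (forall_gaugeLevelValues_le_iff_mem_map_suN N β hPi hP).1 fun t ht => le_csSup hbdd ht

/-- ★★★ **The optimum, unpacked**: `(sup gaugeLevelValuesSuN) • 1 - P = A σ + A ρ` with `σ` an SOS of
level-`n` test functions and `ρ` a combination of level-`n` rows. [folklore] -/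
theorem exists_gauge_certificate_sSup_suN {n : ℕ}
    {P : C(GaugeConfig d L (Matrix.specialUnitaryGroup (Fin N) ℂ), ℝ)} (hPi : IsGaugeInvariant (⇑P))
    (hP : P ∈ certDomainSuN (d := d) (L := L) N β n) :
    ∃ σ ∈ sosCone (wordTruncation (ι := Edge d L) (fundamentalLatticeRep N) n),
      ∃ ρ ∈ rowSpace (fundamentalLatticeRep N) (suExp N) (fun _ => wilsonAction (fundamentalRep (Fin N)))
        β (wordTruncation (ι := Edge d L) (fundamentalLatticeRep N) n),
        gaugeAvgL d L _ σ + gaugeAvgL d L _ ρ =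
          sSup (gaugeLevelValuesSuN (d := d) (L := L) N β n P) •
            (1 : C(GaugeConfig d L (Matrix.specialUnitaryGroup (Fin N) ℂ), ℝ)) - P := by
  obtain ⟨x, hx, hAx⟩ := PointedCone.mem_map.1 (sSup_smul_one_sub_mem_gaugeCertCone_suN N β hPi hP)
  obtain ⟨σ, hσ, ρ, hρ, rfl⟩ := (mem_certCone_iff _).1 hx
  exact ⟨σ, hσ, ρ, hρ, by rw [← map_add, hAx]⟩

end SuN

end Summit.QuantumFields.GaugeBoot

end
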